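import Summits.Ventures.GridStability.Models.NE39DAEHessianTwin
import Summits.Ventures.GridStability.Models.NE39DAEHessianEntries
import Summits.Ventures.GridStability.Models.StructurePreservingDAEStability
import HarnessLib

/-!
# GridStability/Models/NE39DAELocalMin — «NE39-DAE»: the PRINTED 39-bus operating point (Padiyar App. D
# lossless load flow) is a STRICT LOCAL MINIMUM of the printed structure-preserving energy modulo rotation
# and is LIAPUNOV-STABLE modulo rotation for the DAE motions of MODEL MV-4 with smooth positive voltages
# (consequences of the rounded-twin certificate of `NE39DAEHessianTwin.lean`)

LADDER-GRIDFUSION G3/G2 (model register: second half of the MV-4 region sentence on the first 39-bus MV-4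
object), seat gridfusion-model-2 (g9); `plan/MODEL-VALIDITY.md` row **MV-4** (c), instance block
«NE39-DAE» (v0.49: MODELLED tokens «MV-4 + lossless + MV-5P + MV-5Z + classical machines + PRINTED lossless
load flow of [cite: Padiyar2013, App. D Tables D.1–D.4] as half-angle tangents»; data custody model-4
`bench/data/NE39/dae-lossless-pf-packet.json` sha16 `a0db91e6dc3e0b91`). Inputs: `NE39DAEHessianData.lean`
(rational tables, `pinIdx`, `pinnedHessianQ`), `NE39DAEHessianEntries.lean` (`pinnedGram39_eq_literal`:
the literal IS the pinned Gram matrix), `NE39DAEHessianTwin.lean` (`pinnedHessian_quadForm_pos`: `H_pin ≻ 0`,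
certified `λ_min ≥ 1/4`, rounded twin [cite: Rump1999VerifiedLargeSystems, §4 Algorithm 4.1 step 7]); the
generic theorems of `StructurePreservingDAEHessianEntry.lean` (bridge `hessianQuad_pos_of_quadForm_pos`),
`…LocalMin.lean` (second-order sufficiency), `…Stability.lean` (Liapunov stability modulo rotation).

## Contents
* `QL'`, `cos_θ₀` … `QLc_eq`, `tables_matches` — the cast rational tables reproduce `params.hessianQuad`
  at `(δ₀, V₀, θ₀)` exactly; `smoothLoads`.
* `hessianQuad_pos` — the second variation of the energy of [cite: Padiyar2013, §3.4.4 eq (3.32)] at the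
  printed operating point is positive on every nonzero direction with `φ₁ = 0`.
* `energy_lt` — **the printed operating point is a strict local minimum of the printed energy `W` on the
  slice `{θ₁ = θ₁*}`**.
* `forall_dist_pinnedState_lt` (+ `_undamped`) — **Liapunov stability modulo the uniform rotation** for
  every damped (`Dᵢ ≥ 0`) / undamped DAE motion with differentiable bus variables and positive voltages
  [cite: Padiyar2013, §3.4.4 Comment 1]; [cite: HairerNorsettWanner1993, §I.13 Definition 13.1].
THREE COLUMNS. CERTIFIED: the rounded-twin certificate + entry checks (companion files) and the theorems
below (std axioms). MODELLED: MV-4 instance «NE39-DAE»; perturbation class C = DAE motions with C¹ positive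
bus voltages; existence of such motions is the printed modelling assumption. Nothing here is a sentence
about the New England system.
-/

noncomputable section

open Finset Real Set Metric
open Summit.Ventures.GridStability.Models.StructurePreserving (halfAngle halfSin halfCos
  sin_halfAngle cos_halfAngle)
open Summit.Ventures.GridStability.Models.StructurePreservingDAE
open Literature.Computation.Certificates

namespace Summit.Ventures.GridStability.Models.NE39DAE

/-! ### The rational tables are the real objects at the operating point -/

/-- The derivative field of the constant-impedance reactive loads: `Q′_Lk(v) = 2Q⁰_k v/V₀_k²`. -/
def QL' (k : Fin 39) (v : ℝ) : ℝ := 2 * QLc k * v / V₀ k ^ 2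

/-- `cos θ₀_k` is the cast of the half-angle rational `(1 − t²)/(1 + t²)`. -/
theorem cos_θ₀ (k : Fin 39) : Real.cos (θ₀ k) = (((1 - tQ k ^ 2) / (1 + tQ k ^ 2) : ℚ) : ℝ) := by
  rw [θ₀, cos_halfAngle, halfCos]; push_cast; ring

/-- `sin θ₀_k` is the cast of the half-angle rational `2t/(1 + t²)`. -/
theorem sin_θ₀ (k : Fin 39) : Real.sin (θ₀ k) = ((2 * tQ k / (1 + tQ k ^ 2) : ℚ) : ℝ) := by
  rw [θ₀, sin_halfAngle, halfSin]; push_cast; ring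

/-- `cos δ₀_i` is the cast of the half-angle rational `(1 − s²)/(1 + s²)`. -/
theorem cos_δ₀ (i : Fin 10) : Real.cos (δ₀ i) = (((1 - sQ i ^ 2) / (1 + sQ i ^ 2) : ℚ) : ℝ) := by
  rw [δ₀, cos_halfAngle, halfCos]; push_cast; ring

/-- `sin δ₀_i` is the cast of the half-angle rational `2s/(1 + s²)`. -/
theorem sin_δ₀ (i : Fin 10) : Real.sin (δ₀ i) = ((2 * sQ i / (1 + sQ i ^ 2) : ℚ) : ℝ) := by
  rw [δ₀, sin_halfAngle, halfSin]; push_cast; ring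

/-- `Q_net,k(V₀, θ₀) = QnetQ k`. -/
theorem Qnet_eq (k : Fin 39) : core.Qnet V₀ θ₀ k = ((QnetQ k : ℚ) : ℝ) := by
  simp only [Params.Qnet, QnetQ, HessianTables.Cb, tables0, core, V₀, B_eq_cast]
  push_cast
  congr 1
  refine Finset.sum_congr rfl fun l _ => ?_
  rw [Real.cos_sub, cos_θ₀, cos_θ₀, sin_θ₀, sin_θ₀]
  push_cast
  ring

/-- `Q_Gbus,k(δ₀, V₀, θ₀) = QGbusQ k`. -/
theorem QGbus_eq (k : Fin 39) : core.QGbus δ₀ V₀ θ₀ k = ((QGbusQ k : ℚ) : ℝ) := by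
  simp only [Params.QGbus, QGbusQ]
  push_cast
  refine Finset.sum_congr (by rfl) fun i _ => ?_
  simp only [Params.QG, QGQ, HessianTables.Cm, tables0, core, V₀]
  rw [Real.cos_sub, cos_θ₀, cos_δ₀, sin_θ₀, sin_δ₀]
  push_cast
  ring

/-- The real reactive load level of `NE39DAE.lean` is the rational `Q0Q`. -/
theorem QLc_eq (k : Fin 39) : QLc k = ((Q0Q k : ℚ) : ℝ) := by
  rw [QLc, Qnet_eq, QGbus_eq, Q0Q]
  push_cast
  ring

/-- **The cast tables match the instance at its operating point** (data, cos/sin, load coefficient).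
[cite: Padiyar2013, §3.4.4 eq (3.32)] -/
theorem tables_matches :
    (NE39DAE.tables.map (Rat.castHom ℝ)).Matches NE39DAE.params NE39DAE.QL' δ₀ V₀ θ₀ where
  E_eq := fun _ => rfl
  X_eq := fun _ => rfl
  bus_eq := fun _ => rfl
  B_eq := fun k l => (B_eq_cast k l).symm
  V_eq := fun _ => rfl
  cδ_eq := fun i => by
    show (((1 - sQ i ^ 2) / (1 + sQ i ^ 2) : ℚ) : ℝ) = Real.cos (δ₀ i)
    rw [cos_δ₀]
  sδ_eq := fun i => by
    show ((2 * sQ i / (1 + sQ i ^ 2) : ℚ) : ℝ) = Real.sin (δ₀ i)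
    rw [sin_δ₀]
  cθ_eq := fun k => by
    show (((1 - tQ k ^ 2) / (1 + tQ k ^ 2) : ℚ) : ℝ) = Real.cos (θ₀ k)
    rw [cos_θ₀]
  sθ_eq := fun k => by
    show ((2 * tQ k / (1 + tQ k ^ 2) : ℚ) : ℝ) = Real.sin (θ₀ k)
    rw [sin_θ₀]
  q_eq := fun k => by
    show ((Q0Q k / VQ k ^ 2 : ℚ) : ℝ) = (QL' k (V₀ k) * V₀ k - params.QL k (V₀ k)) / V₀ k ^ 2
    have hV : V₀ k ≠ 0 := V₀_ne_zero k
    simp only [params, Loads.constantImpedance, QL', QLc_eq, V₀] at hV ⊢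
    push_cast
    field_simp
    ring

/-- The loads of the instance are smooth in the sense of `SmoothLoads` (constant-P; constant-Z
reactive with derivative `QL'`). [cite: Kundur1994, §7.1.1 (exponents 0 and 2)] -/
theorem smoothLoads : NE39DAE.params.SmoothLoads NE39DAE.V₀ NE39DAE.QL' where
  PL_const := fun _ _ => rfl
  QL_hasDerivAt := fun k v _ => by
    change HasDerivAt (fun V => QLc k * (V / V₀ k) ^ 2) (QL' k v) v
    have h := (((hasDerivAt_id v).div_const (V₀ k)).pow 2).const_mul (QLc k)
    refine h.congr_deriv ?_
    rw [show (2 - 1 : ℕ) = 1 from rfl, pow_one]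
    simp only [QL', id]
    push_cast
    ring
  QL'_continuousOn := fun k => by
    apply Continuous.continuousOn
    unfold QL'
    fun_prop

/-! ### Consequences for MODEL MV-4 instance «NE39-DAE» -/

/-- **Positive second variation on the pinned directions**: at the typed operating point,
`hessianQuad` is positive on every nonzero direction `(a, u, φ)` with `φ₁ = 0`.
[cite: Padiyar2013, §3.4.4 eqs (3.32)–(3.37)] -/
theorem hessianQuad_pos (a : Fin 10 → ℝ) (u φ : Fin 39 → ℝ) (hφ : φ 0 = 0) (hne : (a, u, φ) ≠ 0) :
    0 < params.hessianQuad QL' δ₀ a V₀ θ₀ u φ :=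
  HessianTables.hessianQuad_pos_of_quadForm_pos tables tables_matches
    (fun i => by
      have h : ∀ i, (0 : ℚ) < XdQ i := by decide +kernel
      exact (h i).ne')
    pinIdx_injective 0 (fun I hI => pinIdx_range I hI)
    (fun x hx => by rw [pinnedGram39_eq_literal]; exact pinnedHessian_quadForm_pos x hx) a u φ hφ hne

/-- **The PRINTED 39-bus operating point is a STRICT LOCAL MINIMUM of the printed energy on the
pinned slice**: there is `r > 0` such that `W(δ₀ + a, ω_s + α, V₀ + u, θ₀ + φ) > W(δ₀, ω_s, V₀, θ₀)` for every
nonzero `(a, α, u, φ)` with `φ₁ = 0` and sup-norm `< r`. MODEL MV-4 instance «NE39-DAE».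
[cite: Padiyar2013, §3.4.4 eq (3.32); SauerPai1998, §9.8] -/
theorem energy_lt :
    ∃ r > 0, ∀ (a α : Fin 10 → ℝ) (u φ : Fin 39 → ℝ), φ 0 = 0 → (a, α, u, φ) ≠ 0 →
      ‖((a, α, u, φ) : (Fin 10 → ℝ) × (Fin 10 → ℝ) × (Fin 39 → ℝ) × (Fin 39 → ℝ))‖ < r →
      params.energy V₀ δ₀ (fun _ => params.ωs) V₀ θ₀
        < params.energy V₀ (fun i => δ₀ i + a i) (fun i => params.ωs + α i) (fun k => V₀ k + u k)
            (fun k => θ₀ k + φ k) :=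
  Params.energy_lt_of_hessianQuad_pos wellFormed isOperatingPoint
    (fun k => by show (0 : ℝ) < (VQ k : ℝ); exact_mod_cast VQ_pos k) smoothLoads 0 hessianQuad_pos

/-- **LIAPUNOV STABILITY OF THE TYPED OPERATING POINT, MODULO THE UNIFORM ROTATION, FOR THE DAE
MOTIONS OF MODEL MV-4 INSTANCE «NE39-DAE»** (the printed New England 39-bus operating point): for every `ε > 0` there is `η > 0` such that for every
damping `D ≥ 0` (incl. `D = 0`, the printed undamped model) and every motion of the structure-preserving
DAE with differentiable bus variables and positive voltages [cite: Padiyar2013, §3.4.4 Comment 1],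
if the pinned initial state (all angles read relative to bus 1) is within `η` of
`(δ₀, ω_s, V₀, θ₀)`, then the pinned state stays within `ε` of it for all `t ≥ 0`. CERTIFIED: rounded-twin
PD certificate `pinnedHessian_quadForm_pos` + the kernel theorems of `StructurePreservingDAEStability`;
MODELLED: MV-4 tokens of `NE39DAE.lean`; no sentence about the New England system.
[cite: HairerNorsettWanner1993, §I.13 Definition 13.1, eqs (13.15)–(13.17)] -/
theorem forall_dist_pinnedState_lt {ε : ℝ} (hε : 0 < ε) :
    ∃ η > 0, ∀ (D : Fin 10 → ℝ) (δ ω : ℝ → Fin 10 → ℝ) (V θ : ℝ → Fin 39 → ℝ),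
      (∀ i, 0 ≤ D i) → params.IsDampedSolution D δ ω V θ →
      (∀ k, Differentiable ℝ fun t => V t k) → (∀ k, Differentiable ℝ fun t => θ t k) →
      (∀ t k, 0 < V t k) →
      dist (Params.pinnedState 0 (θ₀ 0) (δ 0) (ω 0) (V 0) (θ 0))
        ((δ₀, fun _ => params.ωs, V₀, θ₀) : Params.PhaseSpace 10 39) < η →
      ∀ t, 0 ≤ t → dist (Params.pinnedState 0 (θ₀ 0) (δ t) (ω t) (V t) (θ t))
        ((δ₀, fun _ => params.ωs, V₀, θ₀) : Params.PhaseSpace 10 39) < ε :=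
  Params.forall_dist_pinnedState_lt_of_hessianQuad_pos wellFormed isOperatingPoint
    (fun k => by show (0 : ℝ) < (VQ k : ℝ); exact_mod_cast VQ_pos k) smoothLoads 0
    hessianQuad_pos hε

/-- The undamped printed model as a special case: every `IsSolution` with smooth positive voltages
starting (pinned) `η`-close stays `ε`-close. [cite: SauerPai1998, §7.9.2 eqs (7.193)–(7.196)] -/
theorem forall_dist_pinnedState_lt_undamped {ε : ℝ} (hε : 0 < ε) :
    ∃ η > 0, ∀ (δ ω : ℝ → Fin 10 → ℝ) (V θ : ℝ → Fin 39 → ℝ), params.IsSolution δ ω V θ →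
      (∀ k, Differentiable ℝ fun t => V t k) → (∀ k, Differentiable ℝ fun t => θ t k) →
      (∀ t k, 0 < V t k) →
      dist (Params.pinnedState 0 (θ₀ 0) (δ 0) (ω 0) (V 0) (θ 0))
        ((δ₀, fun _ => params.ωs, V₀, θ₀) : Params.PhaseSpace 10 39) < η →
      ∀ t, 0 ≤ t → dist (Params.pinnedState 0 (θ₀ 0) (δ t) (ω t) (V t) (θ t))
        ((δ₀, fun _ => params.ωs, V₀, θ₀) : Params.PhaseSpace 10 39) < ε := by
  obtain ⟨η, hη, h⟩ := forall_dist_pinnedState_lt hε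
  exact ⟨η, hη, fun δ ω V θ hsol hVd hθd hVpos h0 =>
    h 0 δ ω V θ (fun _ => le_rfl) hsol.isDampedSolution_zero hVd hθd hVpos h0⟩

end Summit.Ventures.GridStability.Models.NE39DAE

end
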